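import Summits.QuantumFields.BalabanUV.T4Continuum.Support.RegionGaugeHoled

/-!
# `BalabanUV.T4Continuum.Support.RegionGaugeScattered` — NE2 (node U1a) formalisation swarm, SUPPLIER item «Δ1-VEC-W1-HOLED» under the
# owner's sub-row `T4-U1a.S-NE2-D1-DIRICHLET°` (vector layer W1), file 5: **W1 WITH THE SAME LEVEL-UNIFORM CONSTANT ON THE COMPLEMENT OF
# ANY SCATTERED SET OF BLOCKS** (finitely many exterior blocks whose `3^d`-collars are pairwise disjoint) «not in print; our construction»
# (unit b2b-balaban-t4-ne2-formalise-leaf-09, gen 9, v1)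

HONEST FRAMING (T4-DAG p. 1).  [folklore] `U = 1`, the faithful single-scale star-bond operator, ONE region `S = T ∖ E` with `E` a finite
set of blocks that is SCATTERED: `cblk w k ≠ cblk w′ k′` for `w ≠ w′` in `E` and all offsets `k, k′ ∈ {0,1,2}^d` (ℓ∞ block distance
`≥ 3` on the torus; `3 ≤ M_ν`).  Same argument as `RegionGaugeHoled` with the correction `λ = Σ_{w ∈ E} lift_w μ̃`: the lifts have
DISJOINT supports and disjoint gradient supports (each inside its own collar), so `nsq (∂λ) ≤ Σ_w nsq (∂ lift_w μ̃)`, and the in-block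
gradient sums of `μ̃` over the DISTINCT exterior blocks add up inside `nsq (ext A − ∂μ̃)` (`sum_gradSum_le_residual`).  The constant is the
SAME `holedConst d a a′` — free of `n`, `M`, `E`.  This is the kernel form, on the scattered class, of the OPEN item «W1 on general
contact-free unions» of the owner's R32 (b); exterior components larger than one block (boxes of blocks, L-shapes, …) need a
component-wise extension operator and are NOT treated.  Nothing printed is a hypothesis; NE2 (U1a) NOT proved; spine PROVED 0/9 unchanged;
NOT [B9] (3.16)∕(3.23)–(3.27) as printed; NOT infinite volume, NOT the mass gap, NOT Clay.  HONEST DEPENDENCY (verbatim): «continuum YM on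
T⁴ ⇐ BetaPertH ∧ nine spine estimates (0/9 proved); BetaPertH ⇐ (D1) ∧ (D4) ∧ CAP+tail; G-an2-4 gates asym, D1 and NE2/3/4.»

ABSOLUTE RULE (cell, verbatim): «No internally-minted statement may enter as a cited fact. Every hypothesis is either kernel-proved in
this package or a verbatim quotation of a PUBLISHED theorem with page reference. The manuscript(s) under audit are NOT citable for
their own disputed steps — they are the thing under adjudication; programme-internal (2001/route/tribunal) claims are never citable.»
[folklore] throughout; no def, no `def … : Prop` (the separation is a plain `∀` hypothesis on the finite set `E`).  NOT CLAIMED: exterior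
components of more than one block; W3̃; NE2; NE3.
-/

noncomputable section

open scoped BigOperators ComplexConjugate Matrix Matrix.Norms.L2Operator
open Finset

namespace Summit.QuantumFields.BalabanUV.T4Continuum.RegionGaugeScattered

open Literature.MathematicalPhysics.QuantumFieldTheory.Balaban1983to89.B5Prop11Plancherel (Tor fine unitVec)
open Literature.MathematicalPhysics.QuantumFieldTheory.Balaban1983to89.B5Prop11Lower (nsq nsq_nonneg)
open Literature.MathematicalPhysics.QuantumFieldTheory.Balaban1983to89.B5Action121 (GradOp GradOp_mulVec sdiff sdiff_mulVec)
open Literature.MathematicalPhysics.QuantumFieldTheory.Balaban1983to89.B5Block118 (bpt QsOp)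
open Literature.MathematicalPhysics.QuantumFieldTheory.Balaban1983to89.B5Blocks16 (blockOf blockOf_bpt)
open Literature.MathematicalPhysics.QuantumFieldTheory.Balaban1983to89.B5G183RateUnitTower (lev)
open Summit.QuantumFields.BalabanUV.T4Continuum
open Summit.QuantumFields.BalabanUV.T4Continuum.SubtypeCompression (Coercive ext ext_apply_of ext_apply_of_not nsq_ext)
open Summit.QuantumFields.BalabanUV.T4Continuum.ScalarAveragedPropagator (gammaPs)
open Summit.QuantumFields.BalabanUV.T4Continuum.ScalarAveragedCompression (sigma0 sigma0_pos)
open Summit.QuantumFields.BalabanUV.T4Continuum.RegionScalarCompression (QOm GOm)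
open Summit.QuantumFields.BalabanUV.T4Continuum.RegionGaugeFixedVector (starReg curlR gradR avgR regionDeltaA)
open Summit.QuantumFields.BalabanUV.T4Continuum.RegionGaugeSlice (SliceCoercive)
open Summit.QuantumFields.BalabanUV.T4Continuum.RegionGaugeSliceOrth (OrthSliceCoercive)
open Summit.QuantumFields.BalabanUV.T4Continuum.RegionGaugeSliceOrthRegion (sliceCoercive_region_of_orthSlice
  coercive_regionDeltaA_of_orthSlice opNorm_inv_regionDeltaA_le_of_orthSlice)
open Summit.QuantumFields.BalabanUV.T4Continuum.RegionGaugeOrbit (orbitConst orbitConst_pos orthSlice_of_gaugePoincare)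
open Summit.QuantumFields.BalabanUV.T4Continuum.RegionStarLineGaugeTower (orthSlice_one orbitConst_le)
open Summit.QuantumFields.BalabanUV.T4Continuum.DirichletRegionTower (gamD gamD_pos)
open Summit.QuantumFields.BalabanUV.T4Continuum.RegionCollarFold
open Summit.QuantumFields.BalabanUV.T4Continuum.RegionCollarCutoff
open Summit.QuantumFields.BalabanUV.T4Continuum.RegionCollarLift
open Summit.QuantumFields.BalabanUV.T4Continuum.RegionGaugeHoled
open Summit.QuantumFields.BalabanUV.Beta.GAN24.DirichletBoxCompression (toBlock_mulVec')
open Summit.QuantumFields.BalabanUV.Beta.GAN24.DirichletBoxTrace (blockReg)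

variable {d : ℕ} (n : ℕ) [NeZero n] (M : Fin d → ℕ) [hM : ∀ μ, NeZero (M μ)] (E : Finset (Tor M)) (a a' : ℝ)


/-! ## §1 Disjoint collars -/

/-- under the separation hypothesis the collars of distinct blocks of `E` are disjoint. [folklore] -/
theorem not_mem_collar_of_mem (hsep : ∀ w ∈ E, ∀ w' ∈ E, w ≠ w' → ∀ k k' : Fin d → Fin 3, cblk M w k ≠ cblk M w' k')
    {w w' : Tor M} (hw : w ∈ E) (hw' : w' ∈ E) (hne : w ≠ w') {x : Tor (fine n M)} (hx : x ∈ collar n M w) :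
    x ∉ collar n M w' := by
  intro hx'
  apply hsep w hw w' hw' hne (kfin n M w x hx) (kfin n M w' x hx')
  rw [← blockOf_eq_cblk n M w x hx, ← blockOf_eq_cblk n M w' x hx']

/-- a site of a block `w′ ∈ E` is not in the collar of another block `w ∈ E`. [folklore] -/
theorem not_mem_collar_of_blockOf (hsep : ∀ w ∈ E, ∀ w' ∈ E, w ≠ w' → ∀ k k' : Fin d → Fin 3, cblk M w k ≠ cblk M w' k')
    {w w' : Tor M} (hw : w ∈ E) (hw' : w' ∈ E) (hne : w ≠ w') {x : Tor (fine n M)} (hx : blockOf n M x = w') :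
    x ∉ collar n M w := by
  intro hxc
  apply hsep w hw w' hw' hne (kfin n M w x hxc) (fun _ => 1)
  rw [← blockOf_eq_cblk n M w x hxc, hx, cblk_one]

/-! ## §2 The summed lift -/

/-- **THE SCATTERED CORRECTION** `λ = Σ_{w ∈ E} lift_w μ̃`. [folklore] -/
def liftE (μt : Tor (fine n M) → ℂ) : Tor (fine n M) → ℂ := ∑ w ∈ E, lift n M w μt

/-- **`λ = μ̃` ON EVERY BLOCK OF `E`** (`3 ≤ M_ν`). [folklore] -/
theorem liftE_of_blockOf (hM3 : ∀ μ, 3 ≤ M μ)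
    (hsep : ∀ w ∈ E, ∀ w' ∈ E, w ≠ w' → ∀ k k' : Fin d → Fin 3, cblk M w k ≠ cblk M w' k')
    (μt : Tor (fine n M) → ℂ) {x : Tor (fine n M)} {w₀ : Tor M} (hw₀ : w₀ ∈ E) (hx : blockOf n M x = w₀) :
    liftE n M E μt x = μt x := by
  have hM2 : ∀ μ, 2 ≤ M μ := fun μ => le_of_lt (hM3 μ)
  rw [liftE, Finset.sum_apply, ← Finset.add_sum_erase E _ hw₀, lift_of_blockOf_eq n M w₀ hM2 μt hx]
  rw [Finset.sum_eq_zero, add_zero]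
  intro w hw
  have hne : w ≠ w₀ := ne_of_mem_erase hw
  exact lift_of_not_mem n M w μt (not_mem_collar_of_blockOf n M E hsep (mem_of_mem_erase hw) hw₀ hne hx)

/-- **THE GRADIENT OF `λ` IS CARRIED BY ONE COLLAR AT A TIME**: `nsq (∂λ) ≤ Σ_{w ∈ E} nsq (∂ lift_w μ̃)`. [folklore] -/
theorem nsq_grad_liftE_le (hM3 : ∀ μ, 3 ≤ M μ)
    (hsep : ∀ w ∈ E, ∀ w' ∈ E, w ≠ w' → ∀ k k' : Fin d → Fin 3, cblk M w k ≠ cblk M w' k') (μt : Tor (fine n M) → ℂ) :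
    nsq (GradOp (fine n M) (n : ℂ) *ᵥ liftE n M E μt) ≤ ∑ w ∈ E, nsq (GradOp (fine n M) (n : ℂ) *ᵥ lift n M w μt) := by
  classical
  have hlin : GradOp (fine n M) (n : ℂ) *ᵥ liftE n M E μt = ∑ w ∈ E, GradOp (fine n M) (n : ℂ) *ᵥ lift n M w μt := by
    rw [liftE, Matrix.mulVec_sum]
  unfold nsq
  rw [Finset.sum_comm]
  refine sum_le_sum fun b _ => ?_
  rw [hlin, Finset.sum_apply]
  obtain ⟨x, ρ⟩ := b
  -- the gradient of each lift at a bond starting outside its collar vanishes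
  have hzero : ∀ w ∈ E, x ∉ collar n M w → (GradOp (fine n M) (n : ℂ) *ᵥ lift n M w μt) (x, ρ) = 0 := by
    intro w _ hx
    rw [GradOp_mulVec, sdiff_mulVec, lift_step_of_not_mem n M w hM3 μt hx ρ, mul_zero]
  by_cases h : ∃ w₀ ∈ E, x ∈ collar n M w₀
  · obtain ⟨w₀, hw₀, hx₀⟩ := h
    have hothers : ∀ w ∈ E.erase w₀, (GradOp (fine n M) (n : ℂ) *ᵥ lift n M w μt) (x, ρ) = 0 := fun w hw =>
      hzero w (mem_of_mem_erase hw) (not_mem_collar_of_mem n M E hsep hw₀ (mem_of_mem_erase hw) (ne_of_mem_erase hw).symm hx₀)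
    rw [← Finset.add_sum_erase E _ hw₀, Finset.sum_eq_zero hothers, add_zero,
      ← Finset.add_sum_erase E (fun w => ‖(GradOp (fine n M) (n : ℂ) *ᵥ lift n M w μt) (x, ρ)‖ ^ 2) hw₀]
    have : 0 ≤ ∑ w ∈ E.erase w₀, ‖(GradOp (fine n M) (n : ℂ) *ᵥ lift n M w μt) (x, ρ)‖ ^ 2 := sum_nonneg fun _ _ => by positivity
    linarith
  · simp only [not_exists, not_and] at h
    rw [Finset.sum_eq_zero (fun w hw => hzero w hw (h w hw)), norm_zero]
    simp only [ne_eq, OfNat.ofNat_ne_zero, not_false_eq_true, zero_pow]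
    exact sum_nonneg fun _ _ => by positivity

/-! ## §3 The gauge–Poincaré inequality on the complement of a scattered set -/

/-- **THE GAUGE–POINCARÉ INEQUALITY ON `T ∖ E`** (`E` scattered, `3 ≤ M_ν`, `1 ≤ n`, `0 < a`, `0 < a′`): every star field `A` has a
DIRICHLET gauge `μ` on `Ω(S)` with `nsq (A − ∂_Ω μ) ≤ (K/γ_D)·nsq (curlR A) + (K a/γ_D)·(n^d·nsq (avgR A))`, `K = 2 + 4(d+1)3^d`. [folklore] -/
theorem gaugePoincare_scattered (hM3 : ∀ μ, 3 ≤ M μ)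
    (hsep : ∀ w ∈ E, ∀ w' ∈ E, w ≠ w' → ∀ k k' : Fin d → Fin 3, cblk M w k ≠ cblk M w' k')
    (hn : 1 ≤ n) (ha : 0 < a) (ha' : 0 < a') (A : {b // starReg n M (fun y : Tor M => y ∉ E) b} → ℂ) :
    ∃ μ : {x // blockReg n M (fun y : Tor M => y ∉ E) x} → ℂ,
      nsq (A - gradR n M (fun y : Tor M => y ∉ E) *ᵥ μ) ≤ Kholed d / gamD d a * nsq (curlR n M (fun y : Tor M => y ∉ E) *ᵥ A)
        + Kholed d * a / gamD d a * ((n : ℝ) ^ d * nsq (avgR n M (fun y : Tor M => y ∉ E) *ᵥ A)) := by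
  classical
  obtain ⟨μt, hQ, hμt⟩ := exists_torus_gauge n M a a' (fun y : Tor M => y ∉ E) hn ha ha' A
  set R : Tor (fine n M) × Fin d → ℂ := fun b => ext (starReg n M (fun y : Tor M => y ∉ E)) A b - (GradOp (fine n M) (n : ℂ) *ᵥ μt) b with hR
  set lam := liftE n M E μt with hlam
  refine ⟨fun x => μt x.1 - lam x.1, ?_⟩
  have hext : ext (blockReg n M (fun y : Tor M => y ∉ E)) (fun x : {x // blockReg n M (fun y : Tor M => y ∉ E) x} => μt x.1 - lam x.1) = μt - lam := by
    funext x
    by_cases hx : blockReg n M (fun y : Tor M => y ∉ E) x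
    · exact ext_apply_of (blockReg n M (fun y : Tor M => y ∉ E)) _ ⟨x, hx⟩
    · rw [ext_apply_of_not _ _ hx, Pi.sub_apply]
      have hw : blockOf n M x ∈ E := by
        by_contra h
        exact hx h
      rw [hlam, liftE_of_blockOf n M E hM3 hsep μt hw rfl, sub_self]
  have hres : ext (starReg n M (fun y : Tor M => y ∉ E)) (A - gradR n M (fun y : Tor M => y ∉ E) *ᵥ fun x => μt x.1 - lam x.1)
      = fun b => if starReg n M (fun y : Tor M => y ∉ E) b then R b + (GradOp (fine n M) (n : ℂ) *ᵥ lam) b else 0 := by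
    funext b
    by_cases hb : starReg n M (fun y : Tor M => y ∉ E) b
    · rw [if_pos hb, ext_apply_of (starReg n M (fun y : Tor M => y ∉ E)) _ ⟨b, hb⟩, Pi.sub_apply, gradR, toBlock_mulVec', hext, hR]
      simp only
      rw [Matrix.mulVec_sub, Pi.sub_apply, ext_apply_of (starReg n M (fun y : Tor M => y ∉ E)) A ⟨b, hb⟩]
      ring
    · rw [if_neg hb, ext_apply_of_not _ _ hb]
  -- energies
  have hgrad : nsq (GradOp (fine n M) (n : ℂ) *ᵥ lam) ≤ (2 * 3 ^ d + 2 * d * 3 ^ d) * nsq R := by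
    have h1 := nsq_grad_liftE_le n M E hM3 hsep μt
    have h2 := sum_gradSum_le_residual n M (fun y : Tor M => y ∉ E) E (fun w hw h => h hw) A μt
    have h33 : (0 : ℝ) ≤ 2 * d * 3 ^ d := by positivity
    have h22 : (0 : ℝ) ≤ 2 * 3 ^ d := by positivity
    have hw : ∀ w ∈ E, nsq (GradOp (fine n M) (n : ℂ) *ᵥ lift n M w μt) ≤ (2 * 3 ^ d + 2 * d * 3 ^ d) * ∑ ρ, gradSum n M w μt ρ := by
      intro w _
      have h3 := mass_le_gradSum n M w μt (hQ w)
      calc nsq (GradOp (fine n M) (n : ℂ) *ᵥ lift n M w μt)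
          ≤ 2 * 3 ^ d * ∑ ρ, gradSum n M w μt ρ + 2 * d * 3 ^ d * ∑ j : Fin d → Fin n, ‖μt (bpt n M w j)‖ ^ 2 :=
            nsq_grad_lift_le n M w hM3 μt
        _ ≤ 2 * 3 ^ d * ∑ ρ, gradSum n M w μt ρ + 2 * d * 3 ^ d * ∑ ρ, gradSum n M w μt ρ :=
            add_le_add le_rfl (mul_le_mul_of_nonneg_left h3 h33)
        _ = _ := by ring
    calc nsq (GradOp (fine n M) (n : ℂ) *ᵥ lam) ≤ ∑ w ∈ E, nsq (GradOp (fine n M) (n : ℂ) *ᵥ lift n M w μt) := h1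
      _ ≤ ∑ w ∈ E, (2 * 3 ^ d + 2 * d * 3 ^ d) * ∑ ρ, gradSum n M w μt ρ := sum_le_sum hw
      _ = (2 * 3 ^ d + 2 * d * 3 ^ d) * ∑ w ∈ E, ∑ ρ, gradSum n M w μt ρ := by rw [mul_sum]
      _ ≤ (2 * 3 ^ d + 2 * d * 3 ^ d) * nsq R := mul_le_mul_of_nonneg_left h2 (by positivity)
  have hsum : nsq (A - gradR n M (fun y : Tor M => y ∉ E) *ᵥ fun x => μt x.1 - lam x.1) ≤ 2 * nsq R + 2 * nsq (GradOp (fine n M) (n : ℂ) *ᵥ lam) := by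
    rw [← nsq_ext (starReg n M (fun y : Tor M => y ∉ E)), hres]
    unfold nsq
    rw [mul_sum, mul_sum, ← sum_add_distrib]
    refine sum_le_sum fun b _ => ?_
    dsimp only
    split_ifs
    · have := norm_add_le (R b) ((GradOp (fine n M) (n : ℂ) *ᵥ lam) b)
      nlinarith [norm_nonneg (R b + (GradOp (fine n M) (n : ℂ) *ᵥ lam) b), norm_nonneg (R b),
        norm_nonneg ((GradOp (fine n M) (n : ℂ) *ᵥ lam) b), sq_nonneg (‖R b‖ - ‖(GradOp (fine n M) (n : ℂ) *ᵥ lam) b‖)]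
    · rw [norm_zero]
      nlinarith [norm_nonneg (R b), norm_nonneg ((GradOp (fine n M) (n : ℂ) *ᵥ lam) b)]
  have hγ := gamD_pos (d := d) a
  have hRle : nsq R ≤ (nsq (curlR n M (fun y : Tor M => y ∉ E) *ᵥ A) + a * (n : ℝ) ^ d * nsq (avgR n M (fun y : Tor M => y ∉ E) *ᵥ A)) / gamD d a := by
    rw [le_div_iff₀ hγ, mul_comm]; exact hμt
  have hK : nsq (A - gradR n M (fun y : Tor M => y ∉ E) *ᵥ fun x => μt x.1 - lam x.1) ≤ Kholed d * nsq R := by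
    calc nsq (A - gradR n M (fun y : Tor M => y ∉ E) *ᵥ fun x => μt x.1 - lam x.1)
        ≤ 2 * nsq R + 2 * ((2 * 3 ^ d + 2 * d * 3 ^ d) * nsq R) := by linarith [hsum, hgrad]
      _ = Kholed d * nsq R := by rw [Kholed]; ring
  have hKpos : 0 ≤ Kholed d := by unfold Kholed; positivity
  calc nsq (A - gradR n M (fun y : Tor M => y ∉ E) *ᵥ fun x => μt x.1 - lam x.1) ≤ Kholed d * nsq R := hK
    _ ≤ Kholed d * ((nsq (curlR n M (fun y : Tor M => y ∉ E) *ᵥ A) + a * (n : ℝ) ^ d * nsq (avgR n M (fun y : Tor M => y ∉ E) *ᵥ A)) / gamD d a) :=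
        mul_le_mul_of_nonneg_left hRle hKpos
    _ = _ := by simp only [div_eq_mul_inv]; ring

/-! ## §4 ENDs: W1 on the complement of a scattered block set -/

/-- **W1 IN ORBIT FORM ON `T ∖ E`, EVERY LEVEL `n ≥ 1`** (`E` scattered, `3 ≤ M_ν`). [folklore] -/
theorem orthSlice_scattered (hM3 : ∀ μ, 3 ≤ M μ)
    (hsep : ∀ w ∈ E, ∀ w' ∈ E, w ≠ w' → ∀ k k' : Fin d → Fin 3, cblk M w k ≠ cblk M w' k') (ha : 0 < a) (ha' : 0 < a') :
    OrthSliceCoercive (curlR n M (fun y : Tor M => y ∉ E)) (gradR n M (fun y : Tor M => y ∉ E)) (QOm n M (fun y : Tor M => y ∉ E)) (avgR n M (fun y : Tor M => y ∉ E)) (a * (n : ℝ) ^ d)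
      (orbitConst d a (Kholed d / gamD d a) (Kholed d * a / gamD d a)) := by
  by_cases hn : 2 ≤ n
  · exact orthSlice_of_gaugePoincare n M a (fun y : Tor M => y ∉ E) hn ha (KC₂_nonneg a ha)
      (gaugePoincare_scattered n M E a a' hM3 hsep (by omega) ha ha')
  · obtain rfl : n = 1 := by have := NeZero.ne n; omega
    exact orthSlice_one M (fun y : Tor M => y ∉ E) a (orbitConst_le ha (KC₂_nonneg a ha))

/-- **THE DISPLAYED W1 INEQUALITY ON THE COMPLEMENT OF ANY SCATTERED BLOCK SET — ONE LEVEL-UNIFORM CONSTANT** `holedConst d a a′` (free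
of `n`, `M`, `E`): `SliceCoercive (curlR n M S) (gradR n M S) (GOm n M a′ S) (QOm n M S) (avgR n M S) (a·n^d) (holedConst d a a′)` for
`S = T ∖ E`, `3 ≤ M_ν`, `n ≥ 1`, `0 < a`, `0 < a′`. [folklore] -/
theorem sliceCoercive_scattered (hM3 : ∀ μ, 3 ≤ M μ)
    (hsep : ∀ w ∈ E, ∀ w' ∈ E, w ≠ w' → ∀ k k' : Fin d → Fin 3, cblk M w k ≠ cblk M w' k') (ha : 0 < a) (ha' : 0 < a') :
    SliceCoercive (curlR n M (fun y : Tor M => y ∉ E)) (gradR n M (fun y : Tor M => y ∉ E)) (GOm n M a' (fun y : Tor M => y ∉ E)) (QOm n M (fun y : Tor M => y ∉ E)) (avgR n M (fun y : Tor M => y ∉ E)) (a * (n : ℝ) ^ d) (holedConst d a a') :=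
  sliceCoercive_region_of_orthSlice n M a a' (fun y : Tor M => y ∉ E) ha' (orbitConst_pos d ha (KC₂_nonneg a ha)).le
    (orthSlice_scattered n M E a a' hM3 hsep ha ha')

/-- coercivity of `Δ_a(Ω₀)` on `T ∖ E`, uniformly in the level. [folklore] -/
theorem coercive_regionDeltaA_scattered (hM3 : ∀ μ, 3 ≤ M μ)
    (hsep : ∀ w ∈ E, ∀ w' ∈ E, w ≠ w' → ∀ k k' : Fin d → Fin 3, cblk M w k ≠ cblk M w' k') (ha : 0 < a) (ha' : 0 < a') :
    Coercive (regionDeltaA n M a a' (fun y : Tor M => y ∉ E))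
      (min (orbitConst d a (Kholed d / gamD d a) (Kholed d * a / gamD d a) / (1 + 4 * d / sigma0 d a') / 2)
        (1 / (2 * (gammaPs d a')⁻¹))) :=
  coercive_regionDeltaA_of_orthSlice n M a a' (fun y : Tor M => y ∉ E) ha' (orbitConst_pos d ha (KC₂_nonneg a ha)) (orthSlice_scattered n M E a a' hM3 hsep ha ha')

/-- «`G(Ω₀)` exists with a level-uniform bound» on `T ∖ E`. [folklore] -/
theorem opNorm_inv_regionDeltaA_scattered_le (hM3 : ∀ μ, 3 ≤ M μ)
    (hsep : ∀ w ∈ E, ∀ w' ∈ E, w ≠ w' → ∀ k k' : Fin d → Fin 3, cblk M w k ≠ cblk M w' k') (ha : 0 < a) (ha' : 0 < a') :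
    ‖(regionDeltaA n M a a' (fun y : Tor M => y ∉ E))⁻¹‖
      ≤ (min (orbitConst d a (Kholed d / gamD d a) (Kholed d * a / gamD d a) / (1 + 4 * d / sigma0 d a') / 2)
          (1 / (2 * (gammaPs d a')⁻¹)))⁻¹ :=
  opNorm_inv_regionDeltaA_le_of_orthSlice n M a a' (fun y : Tor M => y ∉ E) ha' (orbitConst_pos d ha (KC₂_nonneg a ha))
    (orthSlice_scattered n M E a a' hM3 hsep ha ha')

/-- **THE STAR-TOWER W1 SOCKET DISCHARGED ON `T ∖ E`** (`E` scattered): `∀ k, SliceCoercive (… lev L k …) (holedConst d a a′)`. [folklore] -/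
theorem sliceCoercive_lev_scattered (L : ℕ) [NeZero L] (hM3 : ∀ μ, 3 ≤ M μ)
    (hsep : ∀ w ∈ E, ∀ w' ∈ E, w ≠ w' → ∀ k k' : Fin d → Fin 3, cblk M w k ≠ cblk M w' k') (ha : 0 < a) (ha' : 0 < a') (k : ℕ) :
    SliceCoercive (curlR (lev L k) M (fun y : Tor M => y ∉ E)) (gradR (lev L k) M (fun y : Tor M => y ∉ E)) (GOm (lev L k) M a' (fun y : Tor M => y ∉ E)) (QOm (lev L k) M (fun y : Tor M => y ∉ E)) (avgR (lev L k) M (fun y : Tor M => y ∉ E))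
      (a * ((lev L k : ℕ) : ℝ) ^ d) (holedConst d a a') :=
  sliceCoercive_scattered (lev L k) M E a a' hM3 hsep ha ha'

end Summit.QuantumFields.BalabanUV.T4Continuum.RegionGaugeScattered

end
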